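import Literature.IUT.LogThetaLattice.TensorPackets
import Literature.RingTheory.Etale.PiTensorProductField
import Mathlib.RingTheory.TensorProduct.Pi
import Mathlib.Algebra.Algebra.Prod
import HarnessLib

/-!
# [IUTchIII] Propositions 3.1, 3.2 — proofs (companion of `TensorPackets.lean`)

Proof-only companion (abc-iut cell, DISCHARGE-L6 §E2 LIST A, item A1) of
`Literature/IUT/LogThetaLattice/TensorPackets.lean` (S. Mochizuki, *Inter-universal Teichmüller
theory III*, kurims manuscript (May 2020), §3, Proposition 3.1 pp. 92–93, Proposition 3.2
pp. 97–99; claim key Mochizuki2012, DISPUTED, D-0012 — the content proved here is undisputed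
multilinear algebra). No new definitions; every theorem is about the objects typed there.

* **IUTchIII:Prop3.1(i)** "(Ring Structures)", p. 93 — `Prop31i_ringStructures` DISCHARGED at one
  finite level of the inductive limit: if every `log(^α𝓕_v)` is (replaced by) a finite étale
  `𝕜`-algebra — in particular a finite separable field extension of `𝕜 = ℚ_{v_ℚ}`, or any finite
  field extension as `𝕜` has characteristic `0` — then the holomorphic `n`-tensor packet
  `log(^A𝓕_{v_ℚ}) = ⊗_α ⊕_v log(^α𝓕_v)` is ring-isomorphic to a finite product of fields
  (`Prop31i_ringStructures_of_formallyUnramified`, `…_of_isSeparable`, `…_of_charZero`), by the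
  classical structure theorem for finite étale algebras
  (`Literature/RingTheory/Etale/PiTensorProductField.lean`, Knus–Merkurjev–Rost–Tignol §18.A).
* **IUTchIII:Prop3.1(ii)**, p. 93 — `Prop31ii_integralStructures` DISCHARGED whenever `log(^α𝓕_v)`
  is a field (`Prop31ii_integralStructures_of_isField`: a ring homomorphism out of a field into
  a field is injective, and the integral structure is carried along it); the corrected
  direct-summand reading `Prop31ii_directSummand'` DISCHARGED unconditionally
  (`Prop31ii_directSummand'_of_packets`: `⊗_β ⊕_w log(^β𝓕_w) ≅ (log(^α𝓕_v) ⊗ Z) × ((⊕_{w ≠ v} log(^α𝓕_w)) ⊗ Z)`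
  with `Z = ⊗_{β ≠ α} log(^β𝓕_{v_ℚ})`, from the split-off-one-factor isomorphism
  `⊗_β M_β ≅ M_α ⊗ (⊗_{β≠α} M_β)` and distributivity of `⊗` over finite products).
* **IUTchIII:Prop3.2(i)**, p. 98 — the compatibility isomorphisms are REAL in the typed file; here
  their values on pure tensors and the membership of `MPacketN.compat e` in the poly-isomorphism
  (`MPacketN.compat_tprod`, `MPacketAt.compat_tmul`, `MPacketN.compat_mem_polyCompat`).
* **IUTchIII:Prop3.2(ii)**, pp. 98–99 — the inclusion / transport clauses: membership criteria for
  the shells `𝓘(^α𝒟^⊢_{v_ℚ})`, `𝓘(^A𝒟^⊢_{v_ℚ})`, and the last sentence of (ii) ("with `𝒟^⊢` replaced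
  by `𝓕` … by applying the natural poly-isomorphisms of (i)") as the THEOREM that the transported
  shell `shellPacketN.transport` is the shell packet built from the transported local log-shells
  (`shellPacketN_transport_eq`).
-/

namespace Literature.IUT.LogThetaLattice

open scoped TensorProduct
open PiTensorProduct

universe u v v' w

/-! ### Two pieces of linear-algebra plumbing (used for Proposition 3.1 (ii)) -/

/-- Splitting off one factor of a finite tensor product of algebras:
`⊗_{i} M_i ≅ M_a ⊗ (⊗_{i ≠ a} M_i)` as `R`-algebras, with the evident value on pure tensors
(Mathlib has the underlying linear equivalence: `PiTensorProduct.reindex`, `tmulEquivDep`,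
`subsingletonEquiv`; multiplicativity is checked on pure tensors via `liftAlgHom`). [folklore] -/
private theorem exists_algEquiv_piTensorProduct_split {R : Type*} [CommRing R] {ι : Type*}
    [Fintype ι] [DecidableEq ι] (M : ι → Type*) [∀ i, CommRing (M i)] [∀ i, Algebra R (M i)]
    (a : ι) :
    ∃ e : (⨂[R] i, M i) ≃ₐ[R] M a ⊗[R] (⨂[R] i : {i : ι // i ≠ a}, M i.1),
      ∀ x : ∀ i, M i, e (tprod R x) = x a ⊗ₜ tprod R fun i : {i : ι // i ≠ a} => x i.1 := by
  classical
  let σ : {i // i = a} ⊕ {i // ¬i = a} ≃ ι := Equiv.sumCompl fun i => i = a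
  let N : {i // i = a} ⊕ {i // ¬i = a} → Type _ := fun j => M (σ.symm.symm j)
  let E₁ : (⨂[R] i, M i) ≃ₗ[R] ⨂[R] j, N j := PiTensorProduct.reindex R M σ.symm
  let E₂ := (PiTensorProduct.tmulEquivDep R N).symm
  let E₃ : (⨂[R] i₁ : {i // i = a}, N (.inl i₁)) ≃ₗ[R] M a :=
    PiTensorProduct.subsingletonEquiv (⟨a, rfl⟩ : {i // i = a})
  let E : (⨂[R] i, M i) ≃ₗ[R] M a ⊗[R] (⨂[R] i : {i : ι // i ≠ a}, M i.1) :=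
    E₁ ≪≫ₗ E₂ ≪≫ₗ TensorProduct.congr E₃ (LinearEquiv.refl R _)
  have hE : ∀ x : ∀ i, M i, E (tprod R x) = x a ⊗ₜ tprod R fun i : {i : ι // i ≠ a} => x i.1 := by
    intro x
    have h1 : E₃ (tprod R fun i₁ : {i // i = a} => x (σ.symm.symm (.inl i₁))) = x a :=
      PiTensorProduct.subsingletonEquiv_apply_tprod _ _
    have h2 : E (tprod R x) =
        E₃ (tprod R fun i₁ : {i // i = a} => x (σ.symm.symm (.inl i₁))) ⊗ₜ[R]
          tprod R fun i₂ : {i // ¬i = a} => x (σ.symm.symm (.inr i₂)) := by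
      simp only [E, E₁, E₂, N, LinearEquiv.trans_apply, PiTensorProduct.reindex_tprod,
        PiTensorProduct.tmulEquivDep_symm_apply, TensorProduct.congr_tmul]
      rfl
    rw [h2, h1]
    rfl
  let φ : MultilinearMap R M (M a ⊗[R] (⨂[R] i : {i : ι // i ≠ a}, M i.1)) :=
    (E : (⨂[R] i, M i) →ₗ[R] _).compMultilinearMap (tprod R)
  have hφ : ∀ x, φ x = x a ⊗ₜ tprod R fun i : {i : ι // i ≠ a} => x i.1 := fun x => hE x
  let f : (⨂[R] i, M i) →ₐ[R] M a ⊗[R] (⨂[R] i : {i : ι // i ≠ a}, M i.1) :=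
    PiTensorProduct.liftAlgHom φ (by rw [hφ]; rfl) fun x y => by
      rw [hφ, hφ, hφ, Algebra.TensorProduct.tmul_mul_tmul, tprod_mul_tprod]; rfl
  have hf : ∀ z, f z = E z := by
    have h : f.toLinearMap = (E : (⨂[R] i, M i) →ₗ[R] _) :=
      PiTensorProduct.ext (MultilinearMap.ext fun x => by
        simp only [LinearMap.compMultilinearMap_apply, AlgHom.toLinearMap_apply, f,
          PiTensorProduct.liftAlgHom_apply, PiTensorProduct.lift.tprod, φ, LinearEquiv.coe_coe])
    exact fun z => LinearMap.congr_fun h z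
  have hbij : Function.Bijective f := by
    have : (f : (⨂[R] i, M i) → _) = E := funext hf
    rw [this]; exact E.bijective
  exact ⟨AlgEquiv.ofBijective f hbij, fun x => by
    rw [AlgEquiv.ofBijective_apply, hf, hE]⟩

/-- Splitting off one factor of a finite product of algebras:
`Π_i Y_i ≅ Y_a × Π_{i ≠ a} Y_i` as `R`-algebras. [folklore] -/
private theorem exists_algEquiv_pi_split (R : Type*) [CommSemiring R] {ι : Type*} [DecidableEq ι]
    (Y : ι → Type*) [∀ i, Semiring (Y i)] [∀ i, Algebra R (Y i)] (a : ι) :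
    ∃ e : (∀ i, Y i) ≃ₐ[R] Y a × (∀ i : {i : ι // i ≠ a}, Y i.1),
      ∀ f : ∀ i, Y i, e f = (f a, fun i : {i : ι // i ≠ a} => f i.1) := by
  let φ : (∀ i, Y i) →ₐ[R] Y a × (∀ i : {i : ι // i ≠ a}, Y i.1) :=
    (Pi.evalAlgHom R Y a).prod (AlgHom.pi fun i : {i : ι // i ≠ a} => Pi.evalAlgHom R Y i.1)
  have hφ : ∀ f : ∀ i, Y i, φ f = (f a, fun i : {i : ι // i ≠ a} => f i.1) := fun f => rfl
  refine ⟨AlgEquiv.ofBijective φ ⟨fun f g h => ?_, fun yg => ?_⟩, fun f => by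
    rw [AlgEquiv.ofBijective_apply, hφ]⟩
  · rw [hφ, hφ, Prod.mk.injEq] at h
    funext i
    by_cases hi : i = a
    · subst hi; exact h.1
    · exact congr_fun h.2 ⟨i, hi⟩
  · obtain ⟨y, g⟩ := yg
    refine ⟨Function.update (fun i => if h : i ≠ a then g ⟨i, h⟩ else 0) a y, ?_⟩
    rw [hφ, Prod.mk.injEq]
    refine ⟨Function.update_self .., funext fun i => ?_⟩
    rw [Function.update_of_ne i.2, dif_pos i.2]

/-! ### Proposition 3.1 -/

section Holomorphic

variable (𝕜 : Type u) [Field 𝕜]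
variable {A : Type v} [Fintype A] [DecidableEq A]
variable {Vfib : Type v'} [Fintype Vfib] [DecidableEq Vfib]
variable (L : A → Vfib → Type w) [∀ α v, CommRing (L α v)] [∀ α v, Algebra 𝕜 (L α v)]

omit [DecidableEq A] [DecidableEq Vfib] in
/-- **IUTchIII:Prop3.1(i)** (p. 93) DISCHARGED at a finite level: if every `log(^α𝓕_v)` is a
finite étale (= finite-dimensional, formally unramified) commutative `𝕜`-algebra, then the
holomorphic `n`-tensor packet `log(^A𝓕_{v_ℚ}) = ⊗_{α∈A} ⊕_{v|v_ℚ} log(^α𝓕_v)` "decomposes as a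
direct sum of [finitely many] fields" — `Prop31i_ringStructures 𝕜 L` holds. Classical input:
Knus–Merkurjev–Rost–Tignol §18.A (`Literature.RingTheory.Etale.piTensorProduct_exists_algEquiv_pi_field`).
[claim: Mochizuki2012, status: disputed] -/
theorem Prop31i_ringStructures_of_formallyUnramified [∀ α v, Module.Finite 𝕜 (L α v)]
    [∀ α v, Algebra.FormallyUnramified 𝕜 (L α v)] : Prop31i_ringStructures 𝕜 L := by
  obtain ⟨ι, hι, F, hF, _, _, ⟨e⟩⟩ :=
    Literature.RingTheory.Etale.piTensorProduct_exists_algEquiv_pi_field 𝕜 fun α => Packet1 L α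
  exact ⟨ι, hι, F, hF, ⟨e.toRingEquiv⟩⟩

omit [DecidableEq A] [DecidableEq Vfib] in
/-- **IUTchIII:Prop3.1(i)** (p. 93), field form: if every `log(^α𝓕_v)` is a field, finite and
separable over `𝕜`, then `log(^A𝓕_{v_ℚ})` is ring-isomorphic to a finite product of fields
(`Prop31i_ringStructures 𝕜 L`). [claim: Mochizuki2012, status: disputed] -/
theorem Prop31i_ringStructures_of_isSeparable (hL : ∀ α v, IsField (L α v))
    [∀ α v, Module.Finite 𝕜 (L α v)] [∀ α v, Algebra.IsSeparable 𝕜 (L α v)] :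
    Prop31i_ringStructures 𝕜 L := by
  have : ∀ α v, Algebra.FormallyUnramified 𝕜 (L α v) := fun α v =>
    letI := (hL α v).toField
    Algebra.FormallyUnramified.of_isSeparable 𝕜 (L α v)
  exact Prop31i_ringStructures_of_formallyUnramified 𝕜 L

omit [DecidableEq A] [DecidableEq Vfib] in
/-- **IUTchIII:Prop3.1(i)** (p. 93), characteristic-zero form (the case of the text, `𝕜 = ℚ_{v_ℚ}`,
cf. Remark 3.1.1 (i): `log(^α𝓕_v) ≅ k̄` is an inductive limit of finite extensions of `ℚ_{v_ℚ}`):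
if `𝕜` has characteristic `0` and every `log(^α𝓕_v)` is a field of finite degree over `𝕜`, then
`log(^A𝓕_{v_ℚ})` is ring-isomorphic to a finite product of fields.
[claim: Mochizuki2012, status: disputed] -/
theorem Prop31i_ringStructures_of_charZero [CharZero 𝕜] (hL : ∀ α v, IsField (L α v))
    [∀ α v, Module.Finite 𝕜 (L α v)] : Prop31i_ringStructures 𝕜 L := by
  have : ∀ α v, Algebra.IsSeparable 𝕜 (L α v) := fun α v =>
    letI := (hL α v).toField
    inferInstance
  exact Prop31i_ringStructures_of_isSeparable 𝕜 L hL

omit [Fintype A] [DecidableEq A] [Fintype Vfib] [DecidableEq Vfib] in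
/-- **IUTchIII:Prop3.1(ii)** (p. 93), integral-structure clause, DISCHARGED when `log(^α𝓕_v)` is a
field: for every decomposition `log(^{A,α}𝓕_v) ≅ Π_i K_i` into fields, each composite
`log(^α𝓕_v) → K_i` is injective (a ring homomorphism from a field to a field), and the integral
structure `O α v` is carried to the subring `φ_i(O α v) ⊆ K_i`, which induces it back along the
injection (`Prop31ii_integralStructures 𝕜 L O α v`). [claim: Mochizuki2012, status: disputed] -/
theorem Prop31ii_integralStructures_of_isField (O : ∀ α v, Subring (L α v)) (α : A) (v : Vfib)
    (hL : IsField (L α v)) : Prop31ii_integralStructures 𝕜 L O α v := by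
  intro ι _ K _ e i
  letI := hL.toField
  let φ : L α v →+* K i :=
    (Pi.evalRingHom K i).comp (e.toRingHom.comp (toPacketAt 𝕜 L α v).toRingHom)
  have hφ : Function.Injective φ := φ.injective
  refine ⟨hφ, (O α v).map φ, fun x => ⟨fun hx => Subring.mem_map.mpr ⟨x, hx, rfl⟩, fun hx => ?_⟩⟩
  obtain ⟨y, hy, hxy⟩ := Subring.mem_map.mp hx
  exact hφ hxy ▸ hy

/-- **IUTchIII:Prop3.1(ii)** (p. 93), "`log(^{A,α}𝓕_v)` forms a direct summand of the
[ind-topological] ring `log(^A𝓕_{v_ℚ})`", corrected reading `Prop31ii_directSummand'`, DISCHARGED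
unconditionally: with `Z := ⊗_{β≠α} log(^β𝓕_{v_ℚ})`,
`log(^A𝓕_{v_ℚ}) = ⊗_β ⊕_w log(^β𝓕_w) ≅ (⊕_w log(^α𝓕_w)) ⊗ Z ≅ Π_w (Z ⊗ log(^α𝓕_w))`
`≅ (log(^α𝓕_v) ⊗ Z) × Π_{w ≠ v} (Z ⊗ log(^α𝓕_w)) = log(^{A,α}𝓕_v) × C` as `𝕜`-algebras.
[claim: Mochizuki2012, status: disputed] -/
theorem Prop31ii_directSummand'_of_packets (α : A) (v : Vfib) : Prop31ii_directSummand' 𝕜 L α v := by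
  classical
  obtain ⟨e₁, -⟩ := exists_algEquiv_piTensorProduct_split (R := 𝕜) (fun β => Packet1 L β) α
  obtain ⟨e₄, -⟩ := exists_algEquiv_pi_split 𝕜
    (fun w : Vfib => (⨂[𝕜] β : {β : A // β ≠ α}, Packet1 L β.1) ⊗[𝕜] L α w) v
  refine ⟨∀ w : {w : Vfib // w ≠ v}, (⨂[𝕜] β : {β : A // β ≠ α}, Packet1 L β.1) ⊗[𝕜] L α w.1,
    inferInstance, inferInstance, ⟨?_⟩⟩
  exact e₁.trans <| (Algebra.TensorProduct.comm 𝕜 _ _).trans <|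
    (Algebra.TensorProduct.piRight 𝕜 𝕜 _ (L α)).trans <| e₄.trans <|
      AlgEquiv.prodCongr (Algebra.TensorProduct.comm 𝕜 _ _) AlgEquiv.refl

end Holomorphic

/-! ### Proposition 3.2 -/

section MonoAnalytic

variable (𝕜 : Type u) [Field 𝕜]
variable {A : Type v} {Vfib : Type v'}
variable (D : A → Vfib → Type w) [∀ α v, AddCommGroup (D α v)] [∀ α v, Module 𝕜 (D α v)]
variable {L : A → Vfib → Type w} [∀ α v, CommRing (L α v)] [∀ α v, Algebra 𝕜 (L α v)]

variable {𝕜 D}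

/-- **IUTchIII:Prop3.2(i)** (p. 98): the induced isomorphism of `n`-tensor packets
`log(^A𝒟^⊢_{v_ℚ}) ≅ log(^A𝓕_{v_ℚ})` is the evident one on pure tensors,
`⊗_α x_α ↦ ⊗_α (e_{α,v}(x_{α,v}))_v` (functoriality of `⊗`). [claim: Mochizuki2012, status: disputed] -/
theorem MPacketN.compat_tprod (e : ∀ α v, D α v ≃ₗ[𝕜] L α v) (x : ∀ α, MPacket1 D α) :
    MPacketN.compat e (tprod 𝕜 x) = tprod 𝕜 fun α => fun v => e α v (x α v) := by
  simp only [MPacketN.compat, PiTensorProduct.congr_tprod]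
  rfl

/-- **IUTchIII:Prop3.2(i)** (p. 98): the induced isomorphism `log(^{A,α}𝒟^⊢_v) ≅ log(^{A,α}𝓕_v)`
on elementary tensors `x ⊗ (⊗_β y_β)`. [claim: Mochizuki2012, status: disputed] -/
theorem MPacketAt.compat_tmul (e : ∀ α v, D α v ≃ₗ[𝕜] L α v) (α : A) (v : Vfib) (x : D α v)
    (y : ∀ β : {β : A // β ≠ α}, MPacket1 D β.1) :
    MPacketAt.compat e α v (x ⊗ₜ tprod 𝕜 y) =
      e α v x ⊗ₜ tprod 𝕜 fun β => fun w => e β.1 w (y β w) := by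
  simp only [MPacketAt.compat, TensorProduct.congr_tmul, PiTensorProduct.congr_tprod]
  rfl

/-- **IUTchIII:Prop3.2(i)** (p. 98), "poly-isomorphism": each member `e` of the given
poly-isomorphism `P` induces a member `MPacketN.compat e` of the induced poly-isomorphism of
`n`-tensor packets. [claim: Mochizuki2012, status: disputed] -/
theorem MPacketN.compat_mem_polyCompat {P : Set (∀ α v, D α v ≃ₗ[𝕜] L α v)}
    {e : ∀ α v, D α v ≃ₗ[𝕜] L α v} (he : e ∈ P) :
    MPacketN.compat e ∈ MPacketN.polyCompat P :=
  ⟨e, he, rfl⟩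

variable (D)

/-- **IUTchIII:Prop3.2(ii)** (p. 98), first inclusion: an element of the 1-tensor packet
`log(^α𝒟^⊢_{v_ℚ}) = ⊕_v log(^α𝒟^⊢_v)` lies in `𝓘(^α𝒟^⊢_{v_ℚ}) = ⊕_v 𝓘_{^α𝒟^⊢_v}` iff each of its
components lies in the corresponding log-shell. [claim: Mochizuki2012, status: disputed] -/
theorem mem_shellPacket1_iff (I : ∀ α v, AddSubgroup (D α v)) (α : A) (x : MPacket1 D α) :
    x ∈ shellPacket1 D I α ↔ ∀ v, x v ∈ I α v := by
  simp [shellPacket1, AddSubgroup.mem_pi]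

/-- **IUTchIII:Prop3.2(ii)** (p. 98), second inclusion: a pure tensor `⊗_α x_α` of elements of the
shells `𝓘(^α𝒟^⊢_{v_ℚ})` lies in `𝓘(^A𝒟^⊢_{v_ℚ})`. [claim: Mochizuki2012, status: disputed] -/
theorem tprod_mem_shellPacketN (I : ∀ α v, AddSubgroup (D α v)) (x : ∀ α, MPacket1 D α)
    (hx : ∀ α v, x α v ∈ I α v) : tprod 𝕜 x ∈ shellPacketN 𝕜 D I :=
  AddSubgroup.subset_closure ⟨x, fun α => (mem_shellPacket1_iff D I α (x α)).mpr (hx α), rfl⟩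

/-- **IUTchIII:Prop3.2(ii)** (p. 99), "integral structures on the `ℚ`-spans": the shell
`𝓘(^A𝒟^⊢_{v_ℚ})` is contained in its span `𝓘^ℚ(^A𝒟^⊢_{v_ℚ})`. [claim: Mochizuki2012, status: disputed] -/
theorem shellPacketN_le_shellQSpan (I : ∀ α v, AddSubgroup (D α v)) :
    (shellPacketN 𝕜 D I : Set (MPacketN 𝕜 D)) ⊆ shellQSpan 𝕜 (shellPacketN 𝕜 D I) :=
  shell_le_shellQSpan 𝕜 _

/-- **IUTchIII:Prop3.2(ii)**, last sentence (p. 99): "with `𝒟^⊢` replaced by `𝓕` … for the various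
objects obtained from the `𝒟^⊢`-versions by applying the natural poly-isomorphisms of (i)" — the
holomorphic shell packet `𝓘(^A𝓕_{v_ℚ})`, defined in the typed file as the transport
`shellPacketN.transport` of `𝓘(^A𝒟^⊢_{v_ℚ})` along a member `e` of the compatibility isomorphism,
IS the shell packet formed (by "suitable direct sums and tensor products") from the transported
local log-shells `e_{α,v}(𝓘_{^α𝒟^⊢_v}) ⊆ log(^α𝓕_v)`. [claim: Mochizuki2012, status: disputed] -/
theorem shellPacketN_transport_eq (I : ∀ α v, AddSubgroup (D α v))
    (e : ∀ α v, D α v ≃ₗ[𝕜] L α v) :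
    shellPacketN.transport 𝕜 D I e =
      shellPacketN 𝕜 L fun α v => (I α v).map (e α v).toLinearMap.toAddMonoidHom := by
  rw [shellPacketN.transport, shellPacketN, AddMonoidHom.map_closure, shellPacketN]
  congr 1
  ext t
  simp only [Set.mem_image, Set.mem_setOf_eq]
  constructor
  · rintro ⟨_, ⟨x, hx, rfl⟩, rfl⟩
    refine ⟨fun α => fun v => e α v (x α v), fun α => ?_, ?_⟩
    · rw [mem_shellPacket1_iff]
      exact fun v => AddSubgroup.mem_map.mpr
        ⟨x α v, (mem_shellPacket1_iff D I α (x α)).mp (hx α) v, rfl⟩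
    · simpa using MPacketN.compat_tprod e x
  · rintro ⟨y, hy, rfl⟩
    have hy' : ∀ α v, ∃ x : D α v, x ∈ I α v ∧ e α v x = y α v := fun α v => by
      obtain ⟨x, hx, hxy⟩ :=
        AddSubgroup.mem_map.mp ((mem_shellPacket1_iff L _ α (y α)).mp (hy α) v)
      exact ⟨x, hx, by simpa using hxy⟩
    choose x hxI hxy using hy'
    refine ⟨tprod 𝕜 x, ⟨x, fun α => (mem_shellPacket1_iff D I α (x α)).mpr (hxI α), rfl⟩, ?_⟩
    have h := MPacketN.compat_tprod e x
    simp only [hxy] at h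
    simpa using h

end MonoAnalytic

/-! ### Proposition 3.1: the displayed identification is multiplicative (appended) -/

section DecompositionRing

variable (𝕜 : Type u) [Field 𝕜]
variable {A : Type v} [Fintype A] [DecidableEq A]
variable {Vfib : Type v'} [Fintype Vfib]
variable (L : A → Vfib → Type w) [∀ α v, CommRing (L α v)] [∀ α v, Algebra 𝕜 (L α v)]

/-- **IUTchIII:Prop3.1** (p. 92), the displayed identification
`⊗_{α∈A} log(^α𝓕_{v_ℚ}) = ⊕_{{v_α}} ⊗_{α∈A} log(^α𝓕_{v_α})` (`packetDecomposition`, typed as a `𝕜`-linear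
equivalence) is an identification of RINGS: it underlies a `𝕜`-algebra isomorphism (multiplicativity is
checked on pure tensors, `packetDecomposition_tprod`). This is the sense in which the ring structure of
(i) "decomposes" along the collections `{v_α}`. [claim: Mochizuki2012, status: disputed] -/
theorem exists_algEquiv_eq_packetDecomposition :
    ∃ e : PacketN 𝕜 L ≃ₐ[𝕜] (∀ vA : A → Vfib, PacketSummand 𝕜 L vA),
      ∀ x, e x = packetDecomposition 𝕜 L x := by
  let φ : MultilinearMap 𝕜 (fun α => Packet1 L α) (∀ vA : A → Vfib, PacketSummand 𝕜 L vA) :=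
    (packetDecomposition 𝕜 L : PacketN 𝕜 L →ₗ[𝕜] _).compMultilinearMap (tprod 𝕜)
  have hφ : ∀ a, φ a = fun vA : A → Vfib => tprod 𝕜 fun α => a α (vA α) := fun a =>
    funext fun vA => packetDecomposition_tprod 𝕜 L a vA
  let f : PacketN 𝕜 L →ₐ[𝕜] (∀ vA : A → Vfib, PacketSummand 𝕜 L vA) :=
    PiTensorProduct.liftAlgHom φ (by rw [hφ]; rfl) fun a b => by
      rw [hφ, hφ, hφ]; funext vA; rw [Pi.mul_apply, tprod_mul_tprod]; rfl
  have hf : ∀ z, f z = packetDecomposition 𝕜 L z := by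
    have h : f.toLinearMap = (packetDecomposition 𝕜 L : PacketN 𝕜 L →ₗ[𝕜] _) :=
      PiTensorProduct.ext (MultilinearMap.ext fun a => by
        simp only [LinearMap.compMultilinearMap_apply, AlgHom.toLinearMap_apply, f,
          PiTensorProduct.liftAlgHom_apply, PiTensorProduct.lift.tprod, φ, LinearEquiv.coe_coe])
    exact fun z => LinearMap.congr_fun h z
  have hbij : Function.Bijective f := by
    have : (f : PacketN 𝕜 L → _) = packetDecomposition 𝕜 L := funext hf
    rw [this]; exact (packetDecomposition 𝕜 L).bijective
  exact ⟨AlgEquiv.ofBijective f hbij, fun x => by rw [AlgEquiv.ofBijective_apply, hf]⟩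

/-- **IUTchIII:Prop3.1** (p. 92): `packetDecomposition` is multiplicative.
[claim: Mochizuki2012, status: disputed] -/
theorem packetDecomposition_mul (x y : PacketN 𝕜 L) :
    packetDecomposition 𝕜 L (x * y) = packetDecomposition 𝕜 L x * packetDecomposition 𝕜 L y := by
  obtain ⟨e, he⟩ := exists_algEquiv_eq_packetDecomposition 𝕜 L
  rw [← he, ← he, ← he, map_mul]

/-- **IUTchIII:Prop3.1** (p. 92): `packetDecomposition` is unital. [claim: Mochizuki2012, status: disputed] -/
theorem packetDecomposition_one : packetDecomposition 𝕜 L 1 = 1 := by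
  rw [PiTensorProduct.one_def]
  funext vA
  rw [packetDecomposition_tprod]
  rfl

end DecompositionRing

/-! ### Proposition 3.1 (i) with field binders (ruling D10 (a)); the primed statement -/

section FieldBinders

variable (𝕜 : Type u) [Field 𝕜]
variable {A : Type v} [Fintype A] [DecidableEq A]
variable {Vfib : Type v'} [Fintype Vfib] [DecidableEq Vfib]
variable (L : A → Vfib → Type w) [∀ α v, Field (L α v)] [∀ α v, Algebra 𝕜 (L α v)]

omit [DecidableEq A] [DecidableEq Vfib] in
/-- **IUTchIII:Prop3.1(i)** (p. 93) at the FINITE level, stated EXACTLY with the binders of L6 ruling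
D10 (a) (2026-08-25T19:29:34Z): if every `log(^α𝓕_v)` is a field, finite-dimensional and separable over
`𝕜`, then `Prop31i_ringStructures 𝕜 L` holds — the tensor packet `log(^A𝓕_{v_ℚ})` is ring-isomorphic to
a finite product of fields. (The unprimed predicate is a schema: TRUE under these binders, FALSE at the
Remark 3.1.1 model `L α v = k̄` — never assume it there.) [claim: Mochizuki2012, status: disputed] -/
theorem Prop31i_ringStructures_of_field [∀ α v, FiniteDimensional 𝕜 (L α v)]
    [∀ α v, Algebra.IsSeparable 𝕜 (L α v)] : Prop31i_ringStructures 𝕜 L := by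
  have : ∀ α v, Algebra.FormallyUnramified 𝕜 (L α v) := fun α v =>
    Algebra.FormallyUnramified.of_isSeparable 𝕜 (L α v)
  obtain ⟨ι, hι, F, hF, _, _, ⟨e⟩⟩ :=
    Literature.RingTheory.Etale.piTensorProduct_exists_algEquiv_pi_field 𝕜 fun α => Packet1 L α
  exact ⟨ι, hι, F, hF, ⟨e.toRingEquiv⟩⟩

omit [DecidableEq A] [DecidableEq Vfib] in
/-- **IUTchIII:Prop3.1(i)** (p. 93), finite level, the case of the text (`𝕜 = ℚ_{v_ℚ}` has
characteristic `0`, so separability is automatic): fields `log(^α𝓕_v)` of finite degree over `𝕜`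
give a tensor packet ring-isomorphic to a finite product of fields. [claim: Mochizuki2012, status: disputed] -/
theorem Prop31i_ringStructures_of_field_charZero [CharZero 𝕜] [∀ α v, FiniteDimensional 𝕜 (L α v)] :
    Prop31i_ringStructures 𝕜 L := by
  have : ∀ α v, Algebra.IsSeparable 𝕜 (L α v) := fun α v => inferInstance
  exact Prop31i_ringStructures_of_field 𝕜 L

end FieldBinders

/-! ### Proposition 3.1 (i): the primed statement of the typed file (v3, p405525) -/

section Primed

variable (𝕜 : Type u) [Field 𝕜]
variable {A : Type v} [Fintype A] {Vfib : Type v'} [Fintype Vfib]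
variable (L : A → Vfib → Type w) [∀ α v, Field (L α v)] [∀ α v, Algebra 𝕜 (L α v)]

/-- **IUTchIII:Prop3.1(i)** (p. 93), finite level, for the named statement `Prop31i_ringStructures'`
of the typed file (v3). CAVEAT recorded by the companion seat (finding G-BINDER-DROP, INBOX
2026-08-25T20:2xZ): the section-`variable` hypotheses `[Module.Finite]`, `[Algebra.IsSeparable]`,
`[Fintype]` intended for that def are NOT part of its signature (Lean drops unreferenced instance
variables from a `def`), so `Prop31i_ringStructures' 𝕜 L` is still the schema; THIS theorem supplies
the hypotheses explicitly and proves it under them. [claim: Mochizuki2012, status: disputed] -/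
theorem Prop31i_ringStructures'_of_field [∀ α v, FiniteDimensional 𝕜 (L α v)]
    [∀ α v, Algebra.IsSeparable 𝕜 (L α v)] : Prop31i_ringStructures' 𝕜 L :=
  Prop31i_ringStructures_of_field 𝕜 L

end Primed

end Literature.IUT.LogThetaLattice
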